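import Literature.IUT.HodgeArakelov.EtaleThetaDataOfSettingAutActionTheta
import Literature.IUT.HodgeArakelov.EtaleThetaDataSignTransport
import Literature.IUT.HodgeArakelov.CohomologyAutCoeffChange
import Literature.AnabelianGeometry.EtaleTheta.Discharge.Sec2DeltaThetaTorsionFree

/-!
# GAP row G-w5d169-2 (`hroot`) REDUCED to the `Δ_Θ`-level statement of [EtTh] §1: the root hypothesis of
# [IUTchII] Prop 3.4 (i) / Prop 1.4 is EXACTLY «`α` moves `η̈^Θ|_{Π^tp_Ÿ̲̲}` into its `Π^tp_X̲̲`-conjugacy orbit»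

S. Mochizuki, *The étale theta function …*, Publ. RIMS **45** (2009) [EtTh] (refereed): Thm. 1.6 (iii) p. 24
("the isomorphism of cohomology groups induced by `γ` maps the classes `O^×·η̈^Θ` … to some `Π^tp_X/Π^tp_Y ≅ Z`-conjugate"),
Def. 2.7 p. 41 ("the class `η̈^Θ` determines a class `η̲̈^Θ ∈ H¹(Π^tp_Ÿ̲̲, l·Δ_Θ)` … up to multiplication by a root of unity
of order `l`"), Cor. 2.19 (iii) p. 65 [cite: MochizukiEtTh2009, Cor 2.19(iii) p.65].  S. Mochizuki, *Inter-universal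
Teichmüller theory II*, kurims manuscript (Dec. 2020), Prop. 1.4 p. 27 / Prop. 3.4 (i) p. 91 (claim key `Mochizuki2012`,
DISPUTED, D-0012) [cite: Mochizuki2012, Prop 1.4 p.27].  Transport of structure / change of coefficients in group
cohomology: [cite: NeukirchSchmidtWingberg2008, I §5].

abc-iut cell (WAVE-4 seat abc-iut-w4-d041 gen 7; GAP-LEDGER row **G-w5d169-2**, node IUTchII:Prop3.4(i) binder (P4) of
abc-iut-w5-d169's `EtaleLevels.prop34i_multiradiallyDefined_ofRootHyp`).  PROOF-ONLY (no definition, no `Prop`-valued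
definition, no named fact).  Write `ρ^⊤_α := autActTopOfCor218i α` (abc-iut-w5-d169, p431696), `η̲̈ := rootTop C`,
`cc := ContH1.coeffChange (phi C) (l·Δ_Θ ≤ Δ_Θ) (Π^tp_Ÿ̲̲ ⊓ ⊤)` (abc-iut-w4-d014) and recall `hroot`:
`∀ α, ∃ τ ε, l • ε = 0 ∧ ρ^⊤_α η̲̈ = conj_τ η̲̈ + ε`.  PROVED here:

1. (generic, `ContH1`) `ContH1.coeffChange_eq_one_of_pow_eq_one` — the converse of abc-iut-w4-d014's
   `pow_eq_one_of_coeffChange_eq_one`: if `A'` has no `n`-torsion and every element of `A` is an `n`-th power from `A'`,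
   an `n`-torsion class of `H¹(H, A)` DIES in `H¹(H, A')`; `coeffChange_eq_one_iff_pow_eq_one`, `coeffChange_eq_iff_div_pow_eq_one`.
2. (top level of the genuine data) `exists_torsion_iff_coeffChange_eq` — two classes of `H1 ⊤ ≅ H¹(Π^tp_Ÿ̲̲, l·Δ_Θ)` differ by an
   `l`-torsion class IFF their `Δ_Θ`-images agree (→ needs `Δ_Θ` torsion-free, which holds at `IsEtThOrigin`,
   abc-iut-L2's `deltaTheta_torsionfree`; ← unconditional, `exists_torsion_of_coeffChange_eq`).
3. `rootHyp_of_coeffChange_eq` / `coeffChange_eq_of_rootHyp` — **`hroot` at `α` ⟺ `∃ τ ∈ Π^tp_X̲̲, cc (ρ^⊤_α η̲̈) = cc (conj_τ η̲̈)`**: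
   the `μ_l`-indeterminacy of print is precisely the kernel of `cc`.
4. `autActH1_eq_h1TopAut_of_companion` — whenever `α` has an X-level COMPANION `β ∈ Aut_top((Π^tp_X)^Θ)` (`β ∘ φ = φ ∘ α`),
   w5-d169's Π-intrinsic top action IS abc-iut-L6-t1's pair transport `h1TopAut (α, β)` (top analogue of
   `pairRhoLim_eq_autAct`); hence `coeffChange_autActTop_of_companion`: `cc ∘ ρ^⊤_α = h1TopAut (α, β; Δ_Θ) ∘ cc`.
5. **`rootHyp_of_companion_delta`** — `hroot` at `α` FOLLOWS from the `Δ_Θ`-level, [EtTh] §1-vocabulary statement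
   «`h1TopAut (α, β; Δ_Θ)` carries the pull-back of `η̈^Θ` (`E.etaDd`) to the pull-back of `conj_τ η̈^Θ` for some
   `τ ∈ Π^tp_X̲̲`» — the shape in which F-0587 `Thm16iii` (+ F-0512/F-0513 `Thm110i`/`Thm110iUnique` for the `O^×`-multiple,
   + F-0609 `Prop24` for the extension of `α` to `Π^tp_X`) deliver it; `rootHyp_of_forall_companion_delta` packages all `α`.
READING NOTE for the planner (GAP-LEDGER D-row): the LEVELWISE facts F-0650/F-0652 (`ThetaEnvTower.Cor219_iii(_std)`,
images of the mod-`N` collections) do not by themselves give the single genuine `τ ∈ Π^tp_X̲̲` of `hroot` (the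
`l·ℤ`-orbit is not closed in `lim_N H¹(·, μ_N)`); the Δ_Θ-level top statement of item 5 is the supplier shape.
Nothing here asserts anything of [IUTchII]; no side taken on [IUTchIII] Cor. 3.12; typed ≠ proved.
-/

noncomputable section

open Topology

/-! ### 1. Generic: an `n`-torsion class of `H¹(H, A)` dies in `H¹(H, A')` (`A'` without `n`-torsion, `A ⊆ (A')ⁿ`) -/

namespace Literature.AnabelianGeometry.EtaleTheta

namespace ContH1

open scoped IsMulCommutative

variable {G G' : Type*} [Group G] [TopologicalSpace G]
  [Group G'] [TopologicalSpace G'] [IsTopologicalGroup G']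
  (φ : G →* G') {A A' : Subgroup G'} [A.Normal] [IsMulCommutative A] [A'.Normal] [IsMulCommutative A']
  (hAA' : A ≤ A') (H : Subgroup G)

/-- **Converse torsion transfer**: if `A'` has no `n`-torsion and every `a ∈ A` is `a'ⁿ` for some `a' ∈ A'`, then a class
`x ∈ H¹(H, A)` with `xⁿ = 1` is KILLED by the change of coefficients `H¹(H, A) → H¹(H, A')` (write `fⁿ = ∂a`, `a = bⁿ`;
then `(f/∂b)ⁿ = 1` pointwise in the torsion-free `A'`, so `f = ∂b`). [cite: NeukirchSchmidtWingberg2008, I §5] -/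
theorem coeffChange_eq_one_of_pow_eq_one (n : ℕ) (htf : ∀ a' : A', a' ^ n = 1 → a' = 1)
    (hsurj : ∀ a : A, ∃ a' : A', a' ^ n = Subgroup.inclusion hAA' a)
    (x : ContH1 φ A H) (hx : x ^ n = 1) : coeffChange φ hAA' H x = 1 := by
  induction x using QuotientGroup.induction_on with
  | H f =>
    have hmem : f ^ n ∈ (contCoboundaries φ A H).subgroupOf (contCocycles φ A H) :=
      (QuotientGroup.eq_one_iff _).mp (by rw [QuotientGroup.mk_pow]; exact hx)
    obtain ⟨a, ha⟩ := (mem_contCoboundaries_iff _).mp (Subgroup.mem_subgroupOf.mp hmem)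
    obtain ⟨b, hb⟩ := hsurj a
    change (QuotientGroup.mk (coeffCocycle φ hAA' H f) :
        contCocycles φ A' H ⧸ (contCoboundaries φ A' H).subgroupOf (contCocycles φ A' H)) = 1
    rw [QuotientGroup.eq_one_iff]
    refine Subgroup.mem_subgroupOf.mpr ((mem_contCoboundaries_iff _).mpr ⟨b, ?_⟩)
    funext h
    -- the value `u := (A ↪ A') (f h) / ∂b(h)` has `uⁿ = 1`
    have hfn : Subgroup.inclusion hAA' ((f ^ n).1 h) =
        MulAut.conjNormal (φ (h : G)) (Subgroup.inclusion hAA' a) * (Subgroup.inclusion hAA' a)⁻¹ := by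
      rw [congrFun ha h, map_mul, map_inv, inclusion_conjNormal]
    have e1 : Subgroup.inclusion hAA' ((f ^ n).1 h) = (Subgroup.inclusion hAA' (f.1 h)) ^ n := by
      rw [← map_pow]
      rfl
    have e2 : (Subgroup.inclusion hAA' (f.1 h)) ^ n = MulAut.conjNormal (φ (h : G)) (b ^ n) * (b ^ n)⁻¹ := by
      rw [← e1, hfn, ← hb]
    have e3 : (MulAut.conjNormal (φ (h : G)) b * b⁻¹) ^ n = MulAut.conjNormal (φ (h : G)) (b ^ n) * (b ^ n)⁻¹ := by
      rw [mul_pow, inv_pow, map_pow]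
    have hu : (Subgroup.inclusion hAA' (f.1 h) * (MulAut.conjNormal (φ (h : G)) b * b⁻¹)⁻¹) ^ n = 1 := by
      rw [mul_pow, inv_pow, e2, e3, mul_inv_cancel]
    have := htf _ hu
    rw [mul_inv_eq_one] at this
    rw [coeffCocycle_apply, this]

/-- Hence, under the same hypotheses plus `(A')ⁿ ⊆ A`: **a class dies in `H¹(H, A')` iff it is `n`-torsion**.
[cite: NeukirchSchmidtWingberg2008, I §5] -/
theorem coeffChange_eq_one_iff_pow_eq_one (n : ℕ) (htf : ∀ a' : A', a' ^ n = 1 → a' = 1)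
    (hsurj : ∀ a : A, ∃ a' : A', a' ^ n = Subgroup.inclusion hAA' a) (hpow : ∀ a' : A', ((a' : G') ^ n) ∈ A)
    (x : ContH1 φ A H) : coeffChange φ hAA' H x = 1 ↔ x ^ n = 1 :=
  ⟨pow_eq_one_of_coeffChange_eq_one φ hAA' H n hpow x, coeffChange_eq_one_of_pow_eq_one φ hAA' H n htf hsurj x⟩

/-- … and two classes have the same image in `H¹(H, A')` iff they differ by an `n`-torsion class.
[cite: NeukirchSchmidtWingberg2008, I §5] -/
theorem coeffChange_eq_iff_div_pow_eq_one (n : ℕ) (htf : ∀ a' : A', a' ^ n = 1 → a' = 1)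
    (hsurj : ∀ a : A, ∃ a' : A', a' ^ n = Subgroup.inclusion hAA' a) (hpow : ∀ a' : A', ((a' : G') ^ n) ∈ A)
    (x y : ContH1 φ A H) : coeffChange φ hAA' H x = coeffChange φ hAA' H y ↔ (x / y) ^ n = 1 := by
  rw [← coeffChange_eq_one_iff_pow_eq_one φ hAA' H n htf hsurj hpow, map_div, div_eq_one]

end ContH1

end Literature.AnabelianGeometry.EtaleTheta

namespace Literature.IUT.HodgeArakelov

namespace EtaleThetaDataOfSetting

open Literature.AnabelianGeometry.EtaleTheta (ContH1)
open Literature.AnabelianGeometry.EtaleTheta CohomologySystemOfContH1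

variable {p : ℕ} [Fact p.Prime] {D : Literature.AnabelianGeometry.EtaleTheta.ThetaSetting p}
  {E : D.EtaleThetaData} {l : ℕ} (C : E.DoubleUnderline l)

/-! ### 2. The two hypotheses of §1 at the coefficients `l·Δ_Θ ≤ Δ_Θ` of the genuine data -/

/-- Every element of `l·Δ_Θ` is an `l`-th power from `Δ_Θ` (definition of `l·Δ_Θ`). [cite: MochizukiEtTh2009, Prop 2.12 (i) p.45] -/
theorem exists_pow_eq_inclusion_of_mem_lDeltaTheta (a : D.lDeltaTheta l) :
    ∃ a' : D.DeltaTheta, a' ^ l = Subgroup.inclusion (D.lDeltaTheta_le l) a := by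
  obtain ⟨y, hy, hyl⟩ := a.2
  exact ⟨⟨y, hy⟩, Subtype.ext (by simpa using hyl)⟩

/-- `Δ_Θ` has no `l`-torsion at abc-iut-L2's genuine §1 origin (`IsEtThOrigin`, `deltaTheta_torsionfree`), `l ≠ 0`.
[cite: MochizukiEtTh2009, Prop 1.3 p.17] -/
theorem deltaTheta_pow_eq_one_imp_of_isEtThOrigin (hO : D.IsEtThOrigin) (hl : l ≠ 0) (t : D.DeltaTheta)
    (ht : t ^ l = 1) : t = 1 :=
  Subtype.ext (D.deltaTheta_torsionfree hO t.2 hl (by simpa using congrArg Subtype.val ht))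

variable (htf : ∀ t : D.DeltaTheta, t ^ l = 1 → t = 1)

include htf in
/-- At the genuine coefficients: a class of `H¹(Π^tp_Ÿ̲̲ ∩ J, l·Δ_Θ)` DIES in `H¹(Π^tp_Ÿ̲̲ ∩ J, Δ_Θ)` iff it is `l`-torsion
(`Δ_Θ` without `l`-torsion). [cite: MochizukiEtTh2009, Def 2.7 p.41] -/
theorem coeffChange_eq_one_iff_pow_l_eq_one (J : Subgroup (Pi C))
    (x : ContH1 (phi C) (D.lDeltaTheta l) (PiYdd C ⊓ J)) :
    ContH1.coeffChange (phi C) (D.lDeltaTheta_le l) (PiYdd C ⊓ J) x = 1 ↔ x ^ l = 1 :=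
  ContH1.coeffChange_eq_one_iff_pow_eq_one (phi C) (D.lDeltaTheta_le l) (PiYdd C ⊓ J) l htf
    (exists_pow_eq_inclusion_of_mem_lDeltaTheta (D := D) (l := l)) (pow_mem_lDeltaTheta (D := D) (l := l)) x

include htf in
/-- … and two classes have the same `Δ_Θ`-image iff they differ by an `l`-torsion class. [cite: MochizukiEtTh2009, Def 2.7 p.41] -/
theorem coeffChange_eq_iff_div_pow_l_eq_one (J : Subgroup (Pi C))
    (x y : ContH1 (phi C) (D.lDeltaTheta l) (PiYdd C ⊓ J)) :
    ContH1.coeffChange (phi C) (D.lDeltaTheta_le l) (PiYdd C ⊓ J) x =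
        ContH1.coeffChange (phi C) (D.lDeltaTheta_le l) (PiYdd C ⊓ J) y ↔ (x / y) ^ l = 1 :=
  ContH1.coeffChange_eq_iff_div_pow_eq_one (phi C) (D.lDeltaTheta_le l) (PiYdd C ⊓ J) l htf
    (exists_pow_eq_inclusion_of_mem_lDeltaTheta (D := D) (l := l)) (pow_mem_lDeltaTheta (D := D) (l := l)) x y

/-! ### 3. On `H1 ⊤`: «differ by an `l`-torsion class» ⟺ «same `Δ_Θ`-image» -/

/-- **Unconditional direction**: two top-level classes with the same `Δ_Θ`-image differ by an `l`-torsion class of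
`H1 ⊤ ≅ H¹(Π^tp_Ÿ̲̲, l·Δ_Θ)` (abc-iut-w4-d014's `div_pow_l_eq_one_of_coeffChange_eq` read through `h1Top`).
[cite: MochizukiEtTh2009, Def 2.7 p.41] -/
theorem exists_torsion_of_coeffChange_eq (x y : (coh C).H1 ⊤)
    (h : ContH1.coeffChange (phi C) (D.lDeltaTheta_le l) (PiYdd C ⊓ ⊤) (Additive.toMul (h1Top C x)) =
      ContH1.coeffChange (phi C) (D.lDeltaTheta_le l) (PiYdd C ⊓ ⊤) (Additive.toMul (h1Top C y))) :
    ∃ ε : (coh C).H1 ⊤, l • ε = 0 ∧ x = y + ε := by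
  refine ⟨x - y, ?_, (add_sub_cancel y x).symm⟩
  have hl := div_pow_l_eq_one_of_coeffChange_eq C ⊤ _ _ h
  apply (h1Top C).injective
  rw [map_nsmul, map_zero, map_sub]
  apply Additive.toMul.injective
  rw [toMul_nsmul, toMul_sub, toMul_zero]
  exact hl

include htf in
/-- **`l`-torsion difference ⟺ equal `Δ_Θ`-images** on `H1 ⊤` (→ uses `Δ_Θ` without `l`-torsion).
[cite: MochizukiEtTh2009, Def 2.7 p.41] -/
theorem exists_torsion_iff_coeffChange_eq (x y : (coh C).H1 ⊤) :
    (∃ ε : (coh C).H1 ⊤, l • ε = 0 ∧ x = y + ε) ↔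
      ContH1.coeffChange (phi C) (D.lDeltaTheta_le l) (PiYdd C ⊓ ⊤) (Additive.toMul (h1Top C x)) =
        ContH1.coeffChange (phi C) (D.lDeltaTheta_le l) (PiYdd C ⊓ ⊤) (Additive.toMul (h1Top C y)) := by
  refine ⟨?_, exists_torsion_of_coeffChange_eq C x y⟩
  rintro ⟨ε, hε, rfl⟩
  have hε' : (Additive.toMul (h1Top C ε)) ^ l = 1 := by
    rw [← toMul_nsmul, ← map_nsmul, hε, map_zero, toMul_zero]
  rw [map_add, toMul_add, map_mul, (coeffChange_eq_one_iff_pow_l_eq_one C htf ⊤ _).mpr hε', mul_one]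

/-! ### 4. `hroot` at `α` ⟺ the `Δ_Θ`-class of `ρ^⊤_α η̲̈` is a `Π^tp_X̲̲`-conjugate of the `Δ_Θ`-class of `η̲̈` -/

section RootHyp

variable [(PiYdd C).Normal] (hq : IsQuotientMap D.toTheta) {N : ℕ+} (μ : D.CyclotomeMod l N) (hC : D.Compat) (hS : D.Sec2Hyps)
  (h15 : D.Prop15iii E hC) (L : C.CuspLabels) (R : RigidData.{0} N l) (hR : R = C.rigidData μ hC hS h15 L)
  (h218i : R.Cor218_i)

/-- `h1Top (conj_τ η̲̈) = conj_τ (rootLiftClass)` (bookkeeping). [cite: Mochizuki2012, Prop 1.4 p.27] -/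
theorem toMul_h1Top_h1TopConjEquiv_rootTop (τ : Pi C) :
    Additive.toMul (h1Top C (h1TopConjEquiv (phi C) (D.lDeltaTheta l) (PiYdd C) τ (rootTop C))) =
      ContH1.conj (phi C) (D.lDeltaTheta l) τ (rootLiftClass C) := by
  rw [h1TopConjEquiv_rootTop, AddEquiv.apply_symm_apply, toMul_ofMul]

/-- **`hroot` at `α` FROM the `Δ_Θ`-level**: if the `Δ_Θ`-image of `ρ^⊤_α η̲̈` is the `Δ_Θ`-image of `conj_τ η̲̈` for some
`τ ∈ Π^tp_X̲̲`, then `ρ^⊤_α η̲̈ = conj_τ η̲̈ + ε` with `l • ε = 0` (unconditional direction).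
[cite: MochizukiEtTh2009, Cor 2.19(iii) p.65] -/
theorem rootHyp_of_coeffChange_eq (α : (Pi C) ≃ₜ* (Pi C)) (τ : Pi C)
    (hΔ : ContH1.coeffChange (phi C) (D.lDeltaTheta_le l) (PiYdd C ⊓ ⊤)
        (Additive.toMul (h1Top C (autActTopOfCor218i C hq μ hC hS h15 L R hR h218i α (rootTop C)))) =
      ContH1.coeffChange (phi C) (D.lDeltaTheta_le l) (PiYdd C ⊓ ⊤)
        (ContH1.conj (phi C) (D.lDeltaTheta l) τ (rootLiftClass C))) :
    ∃ τ : Pi C, ∃ ε : (coh C).H1 ⊤, l • ε = 0 ∧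
      autActTopOfCor218i C hq μ hC hS h15 L R hR h218i α (rootTop C) =
        h1TopConjEquiv (phi C) (D.lDeltaTheta l) (PiYdd C) τ (rootTop C) + ε :=
  ⟨τ, exists_torsion_of_coeffChange_eq C _ _ (by rwa [toMul_h1Top_h1TopConjEquiv_rootTop])⟩

include htf in
/-- **Conversely** (`Δ_Θ` without `l`-torsion): `hroot` at `α` gives the `Δ_Θ`-level conjugacy. So `hroot` IS the
print statement «`α` carries the class `η̈^Θ|_{Π^tp_Ÿ̲̲}` to a `Π^tp_X̲̲/Π^tp_Ÿ̲̲ ≅ l·ℤ×μ₂`-conjugate, up to `μ_l`»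
read in `H¹(Π^tp_Ÿ̲̲, l·Δ_Θ)`. [cite: MochizukiEtTh2009, Cor 2.19(iii) p.65] -/
theorem coeffChange_eq_of_rootHyp (α : (Pi C) ≃ₜ* (Pi C)) (τ : Pi C) (ε : (coh C).H1 ⊤) (hε : l • ε = 0)
    (h : autActTopOfCor218i C hq μ hC hS h15 L R hR h218i α (rootTop C) =
      h1TopConjEquiv (phi C) (D.lDeltaTheta l) (PiYdd C) τ (rootTop C) + ε) :
    ContH1.coeffChange (phi C) (D.lDeltaTheta_le l) (PiYdd C ⊓ ⊤)
        (Additive.toMul (h1Top C (autActTopOfCor218i C hq μ hC hS h15 L R hR h218i α (rootTop C)))) =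
      ContH1.coeffChange (phi C) (D.lDeltaTheta_le l) (PiYdd C ⊓ ⊤)
        (ContH1.conj (phi C) (D.lDeltaTheta l) τ (rootLiftClass C)) := by
  rw [← toMul_h1Top_h1TopConjEquiv_rootTop]
  exact (exists_torsion_iff_coeffChange_eq C htf _ _).mp ⟨ε, hε, h⟩

/-- **G-w5d169-2 packaged**: `hroot` (for every `α`) from the family of `Δ_Θ`-level conjugacies.
[cite: MochizukiEtTh2009, Cor 2.19(iii) p.65] -/
theorem rootHyp_of_forall_exists_coeffChange_eq
    (hΔ : ∀ α : (Pi C) ≃ₜ* (Pi C), ∃ τ : Pi C,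
      ContH1.coeffChange (phi C) (D.lDeltaTheta_le l) (PiYdd C ⊓ ⊤)
          (Additive.toMul (h1Top C (autActTopOfCor218i C hq μ hC hS h15 L R hR h218i α (rootTop C)))) =
        ContH1.coeffChange (phi C) (D.lDeltaTheta_le l) (PiYdd C ⊓ ⊤)
          (ContH1.conj (phi C) (D.lDeltaTheta l) τ (rootLiftClass C)))
    (α : (Pi C) ≃ₜ* (Pi C)) :
    ∃ τ : Pi C, ∃ ε : (coh C).H1 ⊤, l • ε = 0 ∧
      autActTopOfCor218i C hq μ hC hS h15 L R hR h218i α (rootTop C) =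
        h1TopConjEquiv (phi C) (D.lDeltaTheta l) (PiYdd C) τ (rootTop C) + ε := by
  obtain ⟨τ, h⟩ := hΔ α
  exact rootHyp_of_coeffChange_eq C hq μ hC hS h15 L R hR h218i α τ h

end RootHyp

/-! ### 5. With an X-level companion `β`: the intrinsic top action IS the pair transport; its `Δ_Θ`-reading -/

section Companion

variable (hq : IsQuotientMap D.toTheta) (α : (Pi C) ≃ₜ* (Pi C))
  (hker : ∀ x, x ∈ (phi C).ker ↔ α x ∈ (phi C).ker)
  (hA : ∀ x, x ∈ (D.lDeltaTheta l).comap (phi C) ↔ α x ∈ (D.lDeltaTheta l).comap (phi C))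
  (hH : ∀ x, x ∈ PiYdd C ↔ α x ∈ PiYdd C)
  (β : D.GtpTheta ≃ₜ* D.GtpTheta) (hφ : ∀ g, β (phi C g) = phi C (α g))

/-- A companion stabilising `Δ_Θ` stabilises `l·Δ_Θ = {yˡ}`. [cite: MochizukiEtTh2009, Prop 2.12 (i) p.45] -/
theorem lDeltaTheta_stable_of_deltaTheta_stable (hΔβ : ∀ a : D.GtpTheta, a ∈ D.DeltaTheta → β a ∈ D.DeltaTheta)
    (a : D.GtpTheta) (ha : a ∈ D.lDeltaTheta l) : β a ∈ D.lDeltaTheta l := by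
  obtain ⟨y, hy, rfl⟩ := ha
  exact ⟨β y, hΔβ y hy, by rw [map_pow]⟩

/-- **The intrinsic top action IS the pair transport** whenever an X-level companion `β` of `α` exists (`β ∘ φ = φ ∘ α`,
`β(l·Δ_Θ) ⊆ l·Δ_Θ`): `autActH1 α = h1TopAut (α, β)` on `H¹(Π^tp_Ÿ̲̲ ⊓ ⊤, l·Δ_Θ)` — both are `f ↦ β ∘ f ∘ α⁻¹`, `β` agreeing with
`rangeAut α` on `φ(Π^tp_X̲̲)` (abc-iut-w5-d169's `h1Equiv_autMap`; top analogue of `pairRhoLim_eq_autAct`).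
[cite: Mochizuki2012, Cor 1.12 (i) p.57] -/
theorem autActH1_eq_h1TopAut_of_companion (hAβ : ∀ a : D.GtpTheta, a ∈ D.lDeltaTheta l → β a ∈ D.lDeltaTheta l)
    (x : ContH1 (phi C) (D.lDeltaTheta l) (PiYdd C ⊓ ⊤)) :
    autActH1 C hq α hker hA hH x = h1TopAut (phi C) (D.lDeltaTheta l) (PiYdd C) α β hφ hAβ hH x := by
  apply (topRestrict C).injective
  rw [topRestrict_autActH1]
  exact (ContH1Restrict.h1Equiv_autMap (phi C) (D.lDeltaTheta l) (phiRange C) (phi_mem_phiRange C)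
    (lDeltaTheta_le_phiRange C) α β (rangeAut C α hker hq) (coe_rangeAut_eq_of_companion C α hker hq β hφ) hφ
    (rangeAut_phiR C α hker hq) hAβ (fun a ha => (mem_lDeltaTheta_iff_rangeAut C α hker hq hA a).mp ha)
    (symm_mem_inf_top (PiYdd C) α hH) x).symm

/-- The same on `H1 ⊤`: `autActTop α = pairRho (α, β)`-shape, read through `h1Top`. [cite: Mochizuki2012, Cor 1.12 (i) p.57] -/
theorem toMul_h1Top_autActTop_of_companion (hAβ : ∀ a : D.GtpTheta, a ∈ D.lDeltaTheta l → β a ∈ D.lDeltaTheta l)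
    (x : (coh C).H1 ⊤) :
    Additive.toMul (h1Top C (autActTop C hq α hker hA hH x)) =
      h1TopAut (phi C) (D.lDeltaTheta l) (PiYdd C) α β hφ hAβ hH (Additive.toMul (h1Top C x)) := by
  obtain ⟨y, rfl⟩ : ∃ y, x = (h1Top C).symm y := ⟨h1Top C x, ((h1Top C).symm_apply_apply x).symm⟩
  rw [autActTop_h1Top_symm, AddEquiv.apply_symm_apply, AddEquiv.apply_symm_apply, toMul_ofMul,
    autActH1_eq_h1TopAut_of_companion C hq α hker hA hH β hφ hAβ]

variable (hΔβ : ∀ a : D.GtpTheta, a ∈ D.DeltaTheta → β a ∈ D.DeltaTheta)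

/-- **`Δ_Θ`-reading of the intrinsic action**: `cc (autActH1 α x) = h1TopAut (α, β; Δ_Θ) (cc x)` (abc-iut-w4-d014's
`coeffChange_h1TopAut`). [cite: NeukirchSchmidtWingberg2008, I §5] -/
theorem coeffChange_autActH1_of_companion (x : ContH1 (phi C) (D.lDeltaTheta l) (PiYdd C ⊓ ⊤)) :
    ContH1.coeffChange (phi C) (D.lDeltaTheta_le l) (PiYdd C ⊓ ⊤) (autActH1 C hq α hker hA hH x) =
      h1TopAut (phi C) D.DeltaTheta (PiYdd C) α β hφ hΔβ hH
        (ContH1.coeffChange (phi C) (D.lDeltaTheta_le l) (PiYdd C ⊓ ⊤) x) := by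
  have hAβ := lDeltaTheta_stable_of_deltaTheta_stable (l := l) β hΔβ
  rw [autActH1_eq_h1TopAut_of_companion C hq α hker hA hH β hφ hAβ]
  exact coeffChange_h1TopAut (phi C) (D.lDeltaTheta_le l) (PiYdd C) α β hφ hAβ hH hΔβ x

/-- … and on `H1 ⊤`: `cc (h1Top (autActTop α x)) = h1TopAut (α, β; Δ_Θ) (cc (h1Top x))`. [cite: NeukirchSchmidtWingberg2008, I §5] -/
theorem coeffChange_autActTop_of_companion (x : (coh C).H1 ⊤) :
    ContH1.coeffChange (phi C) (D.lDeltaTheta_le l) (PiYdd C ⊓ ⊤)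
        (Additive.toMul (h1Top C (autActTop C hq α hker hA hH x))) =
      h1TopAut (phi C) D.DeltaTheta (PiYdd C) α β hφ hΔβ hH
        (ContH1.coeffChange (phi C) (D.lDeltaTheta_le l) (PiYdd C ⊓ ⊤) (Additive.toMul (h1Top C x))) := by
  obtain ⟨y, rfl⟩ : ∃ y, x = (h1Top C).symm y := ⟨h1Top C x, ((h1Top C).symm_apply_apply x).symm⟩
  rw [autActTop_h1Top_symm, AddEquiv.apply_symm_apply, AddEquiv.apply_symm_apply, toMul_ofMul]
  exact coeffChange_autActH1_of_companion C hq α hker hA hH β hφ hΔβ (Additive.toMul y)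

end Companion

/-! ### 6. `hroot` from the [EtTh] §1-level statement «(α, β) carries `η̈^Θ` to a `Π^tp_X̲̲`-conjugate» -/

section CompanionRoot

variable (hq : IsQuotientMap D.toTheta) {N : ℕ+} (μ : D.CyclotomeMod l N) (hC : D.Compat) (hS : D.Sec2Hyps)
  (h15 : D.Prop15iii E hC) (L : C.CuspLabels) (R : RigidData.{0} N l) (hR : R = C.rigidData μ hC hS h15 L)
  (h218i : R.Cor218_i) [(PiYdd C).Normal] [D.GtpYdd.Normal]

omit [(PiYdd C).Normal] [D.GtpYdd.Normal] in
/-- **`Δ_Θ`-reading of `ρ^⊤_α η̲̈` in [EtTh] §1 vocabulary**: for an X-level companion `β` of `α` (stabilising `l·Δ_Θ` and `Δ_Θ`),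
`cc (ρ^⊤_α η̲̈) = h1TopAut (α, β; Δ_Θ) (η̈^Θ pulled back to Π^tp_Ÿ̲̲ ⊆ Π^tp_X̲̲)` (abc-iut-L2-t1's `E.etaDd`, via
`coeffChange_rootLiftClass_eq_comap`). [cite: MochizukiEtTh2009, Def 2.7 p.41] -/
theorem coeffChange_autActTopOfCor218i_rootTop_of_companion (α : (Pi C) ≃ₜ* (Pi C))
    (β : D.GtpTheta ≃ₜ* D.GtpTheta) (hφ : ∀ g, β (phi C g) = phi C (α g))
    (hΔβ : ∀ a : D.GtpTheta, a ∈ D.DeltaTheta → β a ∈ D.DeltaTheta) :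
    ContH1.coeffChange (phi C) (D.lDeltaTheta_le l) (PiYdd C ⊓ ⊤)
        (Additive.toMul (h1Top C (autActTopOfCor218i C hq μ hC hS h15 L R hR h218i α (rootTop C)))) =
      h1TopAut (phi C) D.DeltaTheta (PiYdd C) α β hφ hΔβ (mem_PiYdd_iff_of_cor218_i C μ hC hS h15 L R hR h218i α)
        (ContH1.comap D.toTheta D.DeltaTheta C.Huu.subtype continuous_subtype_val
          (map_subtype_piYdd_inf_le_GtpYdd C ⊤) E.etaDd) := by
  rw [← coeffChange_rootLiftClass_eq_comap]
  unfold autActTopOfCor218i rootTop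
  rw [coeffChange_autActTop_of_companion C hq α _ _ _ β hφ hΔβ, AddEquiv.apply_symm_apply, toMul_ofMul]

/-- **`hroot` at `α` FROM [EtTh] §1**: if some X-level companion `β` of `α` carries (with `α`) the pull-back of `η̈^Θ` to
the pull-back of `conj_τ η̈^Θ`, `τ ∈ Π^tp_X̲̲` — the shape delivered by [EtTh] Thm. 1.6 (iii) (F-0587) with the
`O^×_K̈`-multiple cut to `±1` by Thm. 1.10 (i) (F-0512/F-0513) and the sign absorbed in `Π^tp_X̲̲/Π^tp_Ÿ̲̲ ≅ l·ℤ×μ₂` — then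
`ρ^⊤_α η̲̈ = conj_τ η̲̈ + ε`, `l • ε = 0`. [cite: MochizukiEtTh2009, Thm 1.6 (iii) p.24] -/
theorem rootHyp_of_companion_delta (α : (Pi C) ≃ₜ* (Pi C))
    (β : D.GtpTheta ≃ₜ* D.GtpTheta) (hφ : ∀ g, β (phi C g) = phi C (α g))
    (hΔβ : ∀ a : D.GtpTheta, a ∈ D.DeltaTheta → β a ∈ D.DeltaTheta) (τ : Pi C)
    (hΔ : h1TopAut (phi C) D.DeltaTheta (PiYdd C) α β hφ hΔβ (mem_PiYdd_iff_of_cor218_i C μ hC hS h15 L R hR h218i α)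
        (ContH1.comap D.toTheta D.DeltaTheta C.Huu.subtype continuous_subtype_val
          (map_subtype_piYdd_inf_le_GtpYdd C ⊤) E.etaDd) =
      ContH1.comap D.toTheta D.DeltaTheta C.Huu.subtype continuous_subtype_val
        (map_subtype_piYdd_inf_le_GtpYdd C ⊤) (ContH1.conj D.toTheta D.DeltaTheta (τ : D.PiTemp) E.etaDd)) :
    ∃ τ : Pi C, ∃ ε : (coh C).H1 ⊤, l • ε = 0 ∧
      autActTopOfCor218i C hq μ hC hS h15 L R hR h218i α (rootTop C) =
        h1TopConjEquiv (phi C) (D.lDeltaTheta l) (PiYdd C) τ (rootTop C) + ε := by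
  refine rootHyp_of_coeffChange_eq C hq μ hC hS h15 L R hR h218i α τ ?_
  rw [coeffChange_autActTopOfCor218i_rootTop_of_companion C hq μ hC hS h15 L R hR h218i α β hφ hΔβ, hΔ,
    ← ContH1.conj_coeffChange, conj_coeffChange_rootLiftClass]

/-- **G-w5d169-2 from [EtTh] §1, packaged over all `α`**: if EVERY topological automorphism `α` of `Π^tp_X̲̲` admits an X-level
companion `β_α` carrying `η̈^Θ` to a `Π^tp_X̲̲`-conjugate (up to `μ_l`, invisible at the `Δ_Θ`-level), then `hroot` holds.
[cite: MochizukiEtTh2009, Cor 2.19(iii) p.65] -/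
theorem rootHyp_of_forall_companion_delta
    (hcomp : ∀ α : (Pi C) ≃ₜ* (Pi C), ∃ (β : D.GtpTheta ≃ₜ* D.GtpTheta) (hφ : ∀ g, β (phi C g) = phi C (α g))
      (hΔβ : ∀ a : D.GtpTheta, a ∈ D.DeltaTheta → β a ∈ D.DeltaTheta) (τ : Pi C),
      h1TopAut (phi C) D.DeltaTheta (PiYdd C) α β hφ hΔβ (mem_PiYdd_iff_of_cor218_i C μ hC hS h15 L R hR h218i α)
          (ContH1.comap D.toTheta D.DeltaTheta C.Huu.subtype continuous_subtype_val
            (map_subtype_piYdd_inf_le_GtpYdd C ⊤) E.etaDd) =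
        ContH1.comap D.toTheta D.DeltaTheta C.Huu.subtype continuous_subtype_val
          (map_subtype_piYdd_inf_le_GtpYdd C ⊤) (ContH1.conj D.toTheta D.DeltaTheta (τ : D.PiTemp) E.etaDd))
    (α : (Pi C) ≃ₜ* (Pi C)) :
    ∃ τ : Pi C, ∃ ε : (coh C).H1 ⊤, l • ε = 0 ∧
      autActTopOfCor218i C hq μ hC hS h15 L R hR h218i α (rootTop C) =
        h1TopConjEquiv (phi C) (D.lDeltaTheta l) (PiYdd C) τ (rootTop C) + ε := by
  obtain ⟨β, hφ, hΔβ, τ, hΔ⟩ := hcomp α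
  exact rootHyp_of_companion_delta C hq μ hC hS h15 L R hR h218i α β hφ hΔβ τ hΔ

end CompanionRoot

end EtaleThetaDataOfSetting

end Literature.IUT.HodgeArakelov

end
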